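/-
Origin: expansion seat `planner-pub-hodgecm-mc-glue-1-0`, handover #33 2026-08-18T19:34Z md5 4314741d13a12df79057f4347ddb5aa7 (NEW additive leaf, 143 l., junction J2f = J2d/J2e laws specialised to PerL's regime for regimePieceEmb; PKG CLAIM 19:30:16Z window -> 19:41Z; INSTALL ONLY WITH/AFTER row #32 (imports HodgeCM.Model.Junction.HeckeTranslate); nothing landed imports it; clean-room as-landed rehearsal rc 0, 0 errors, 0 warnings, 0 proof holes; axioms trio 5/5; (`HOME/mc/pub-hodgecm-mc-glue-1/aslanded/HodgeCM/Model/Junction/RegimeLevelChange.lean`, md5 4314741d, 142 lines);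
landed by the packager successor (mc-unitary-1-g3, gen-8 kit) in gate run 32 as `HodgeCM/Model/Junction/RegimeLevelChange.lean` (verbatim).
-/
/-
Origin: speedrun cell pub-hodgecm, MODEL-CONSTRUCTION sub-cell, unit pub-hodgecm-mc-glue-1 (node E-J, junction J2f =
the level-change (J2d) and Hecke-translate (J2e) laws SPECIALISED to PerL's regime, i.e. stated for
`regimePieceEmb` into the END-STATE carrier `(V.latticeModel hP).toQuotientModel.H`), seat
planner-pub-hodgecm-mc-glue-1-0, 2026-08-18.
Target in PKG: HodgeCM/Model/Junction/RegimeLevelChange.lean (NEW additive leaf; nothing landed imports it).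
-/
import Summits.HodgeConjecture.HodgeCM.Model.Junction.HeckeTranslate

/-!
# Junction J2f: level change and Hecke translates in PerL's regime

`HermSpace3.regimePieceEmb` (junction J2c) is `QuotientModel.pieceEmb` for `Q := (V.latticeModel hP).toQuotientModel`,
`G₁ := U(V)(𝔸)`, `Γ₁ := U(V)(L⁺)`, `e := regimeEquiv` — by `rfl` (`regimePieceEmb_eq`). This file restates, with
that plumbing done once, the laws the E seat's discharge of `LevelMeetAt` / `Fact_embRestrict` / `Fact_embSpread`
consumes (E3 `EndStateLevelMeet` roadmap): T1 `coeFn_regimePieceEmb_levelCover_indicator`, T3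
`regimePieceEmb_eq_sum_R`, orthogonality `inner_R_regimePieceEmb_eq_zero`, index law
`inner_regimePieceEmb_eq_card_mul`, Hecke translate `R_regimePieceEmb`, twist `regimePieceEmb_isoComp`, and
unitarity `inner_R_R` of the END-STATE representation. Everything is proved; 0 hypotheses beyond the data; 0 MODEL-N.
-/

set_option autoImplicit false

noncomputable section

open MeasureTheory Literature.MeasureTheory.Group Literature.NumberTheory.Automorphic
open scoped ENNReal InnerProductSpace

namespace HodgeCM

namespace HermSpace3

open HodgeCM.Adelic

variable (hP : PrintFact_unitaryCompact) {L : CMField} {ι₁ : L →+* ℂ} (V : HermSpace3 L ι₁)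
  (h : IsAnisotropic L V.Hm)
  [MeasurableSpace (adelicUnitaryGroup L V.Hm ⧸ adelicUnitaryRat L V.Hm)]
  [BorelSpace (adelicUnitaryGroup L V.Hm ⧸ adelicUnitaryRat L V.Hm)]
  (M : Subgroup (adelicUnitaryGroup L V.Hm)) {A : Type*} [Group A] [TopologicalSpace A] [IsTopologicalGroup A]
  (π : M →* A) (x : adelicUnitaryGroup L V.Hm ⧸ adelicUnitaryRat L V.Hm)
  [CompactSpace (A ⧸ LevelOrbit.pieceLattice M (adelicUnitaryRat L V.Hm) π x)]

omit [IsTopologicalGroup A] in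
/-- `regimePieceEmb` IS `pieceEmb` of the END-STATE quotient model along `regimeEquiv` (definitional). -/
theorem regimePieceEmb_eq (hM : IsOpen (M : Set (adelicUnitaryGroup L V.Hm))) (hπ : Continuous π) :
    V.regimePieceEmb hP h M π x hM hπ =
      (V.latticeModel hP).toQuotientModel.pieceEmb (adelicUnitaryRat L V.Hm) (regimeEquiv L V.Hm h)
        (V.regimeEquiv_mem_latticeModel_Γ_iff hP h) M π x hM hπ :=
  rfl

/-- **Hecke translate in the regime**: the END-STATE representation applied to a regime piece embedding. -/
theorem R_regimePieceEmb (hM : IsOpen (M : Set (adelicUnitaryGroup L V.Hm))) (hπ : Continuous π)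
    (g : adelicUnitaryGroup L V.Hm)
    (f : C(A ⧸ LevelOrbit.pieceLattice M (adelicUnitaryRat L V.Hm) π x, ℂ)) :
    (V.latticeModel hP).toQuotientModel.R (regimeEquiv L V.Hm h g) (V.regimePieceEmb hP h M π x hM hπ f) =
      (V.latticeModel hP).toQuotientModel.pieceEmb (adelicUnitaryRat L V.Hm) (regimeEquiv L V.Hm h)
        (V.regimeEquiv_mem_latticeModel_Γ_iff hP h) (LevelOrbit.conjLevel M g) (LevelOrbit.conjProj M π g)
        (g • x) (LevelOrbit.isOpen_conjLevel M hM g) (LevelOrbit.continuous_conjProj M π hπ g)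
        (f.comp (LevelOrbit.conjCastCM M (adelicUnitaryRat L V.Hm) π g x)) :=
  QuotientModel.R_pieceEmb _ _ _ _ M π x hM hπ g f

/-- **Twist by `c : A ≃ₜ* A'` in the regime.** -/
theorem regimePieceEmb_isoComp {A' : Type*} [Group A'] [TopologicalSpace A'] [IsTopologicalGroup A']
    (c : A ≃ₜ* A') (hM : IsOpen (M : Set (adelicUnitaryGroup L V.Hm))) (hπ : Continuous π)
    (f : C(A' ⧸ LevelOrbit.pieceLattice M (adelicUnitaryRat L V.Hm) ((c.toMulEquiv : A →* A').comp π) x, ℂ)) :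
    V.regimePieceEmb hP h M ((c.toMulEquiv : A →* A').comp π) x hM (c.continuous.comp hπ) f =
      V.regimePieceEmb hP h M π x hM hπ (f.comp (LevelOrbit.isoCastCM M (adelicUnitaryRat L V.Hm) π c x)) :=
  QuotientModel.pieceEmb_isoComp _ _ _ _ M π x c hM hπ f

variable (M' : Subgroup (adelicUnitaryGroup L V.Hm)) (hle : M' ≤ M)
  [CompactSpace (A ⧸ LevelOrbit.pieceLattice M' (adelicUnitaryRat L V.Hm) (π.comp (Subgroup.inclusion hle)) x)]

/-- **T1 in the regime** (`Fact_embRestrict` shape): a.e. on the END-STATE quotient,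
`regimePieceEmb_{M'} (f ∘ levelCover) = 𝟙_{𝒫'} · regimePieceEmb_M f`, `𝒫'` = the sub-piece `M' • x` read through
`regimeEquiv`. -/
theorem coeFn_regimePieceEmb_levelCover_indicator (hM : IsOpen (M : Set (adelicUnitaryGroup L V.Hm)))
    (hπ : Continuous π) (hM' : IsOpen (M' : Set (adelicUnitaryGroup L V.Hm)))
    (f : C(A ⧸ LevelOrbit.pieceLattice M (adelicUnitaryRat L V.Hm) π x, ℂ)) :
    (V.regimePieceEmb hP h M' (π.comp (Subgroup.inclusion hle)) x hM' (hπ.comp (continuous_inclusion hle))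
        (f.comp (LevelOrbit.levelCoverCM M (adelicUnitaryRat L V.Hm) π x M' hle)) :
        (V.latticeModel hP).toQuotientModel.G ⧸ (V.latticeModel hP).toQuotientModel.Γ → ℂ)
      =ᵐ[(V.latticeModel hP).toQuotientModel.ν]
      (cosetCongr (regimeEquiv L V.Hm h).symm.toMulEquiv (V.latticeModel hP).toQuotientModel.Γ
            (adelicUnitaryRat L V.Hm)
            (forall_symm_mem_iff (regimeEquiv L V.Hm h).toMulEquiv (adelicUnitaryRat L V.Hm)
              (V.latticeModel hP).toQuotientModel.Γ (V.regimeEquiv_mem_latticeModel_Γ_iff hP h)) ⁻¹'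
          MulAction.orbit M' x).indicator
        (V.regimePieceEmb hP h M π x hM hπ f :
          (V.latticeModel hP).toQuotientModel.G ⧸ (V.latticeModel hP).toQuotientModel.Γ → ℂ) :=
  QuotientModel.coeFn_pieceEmb_levelCover_indicator _ _ _ _ M π x M' hle hM hπ hM' f

/-- **T3 in the regime** (`Fact_embSpread` shape). -/
theorem regimePieceEmb_eq_sum_R {ι : Type*} [Fintype ι] (hM : IsOpen (M : Set (adelicUnitaryGroup L V.Hm)))
    (hπ : Continuous π) (hM' : IsOpen (M' : Set (adelicUnitaryGroup L V.Hm))) (k : ι → M)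
    (hk : ∀ i, π (k i) = 1)
    (hkN : ∀ i, (k i : adelicUnitaryGroup L V.Hm) ∈ Subgroup.normalizer (M' : Set (adelicUnitaryGroup L V.Hm)))
    (hdisj : ∀ i j, i ≠ j → Disjoint (MulAction.orbit M' (k i • x)) (MulAction.orbit M' (k j • x)))
    (hcover : MulAction.orbit M x ⊆ ⋃ i, MulAction.orbit M' (k i • x))
    (f : C(A ⧸ LevelOrbit.pieceLattice M (adelicUnitaryRat L V.Hm) π x, ℂ)) :
    V.regimePieceEmb hP h M π x hM hπ f =
      ∑ i, (V.latticeModel hP).toQuotientModel.R (regimeEquiv L V.Hm h (k i))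
        (V.regimePieceEmb hP h M' (π.comp (Subgroup.inclusion hle)) x hM' (hπ.comp (continuous_inclusion hle))
          (f.comp (LevelOrbit.levelCoverCM M (adelicUnitaryRat L V.Hm) π x M' hle))) :=
  QuotientModel.pieceEmb_eq_sum_R _ _ _ _ M π x M' hle hM hπ hM' k hk hkN hdisj hcover f

omit [IsTopologicalGroup A] [CompactSpace (A ⧸ LevelOrbit.pieceLattice M (adelicUnitaryRat L V.Hm) π x)] in
/-- **Distinct translates are orthogonal** in the END-STATE carrier. -/
theorem inner_R_regimePieceEmb_eq_zero {ι : Type*} (hπ : Continuous π)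
    (hM' : IsOpen (M' : Set (adelicUnitaryGroup L V.Hm))) (k : ι → M) (hk : ∀ i, π (k i) = 1)
    (hkN : ∀ i, (k i : adelicUnitaryGroup L V.Hm) ∈ Subgroup.normalizer (M' : Set (adelicUnitaryGroup L V.Hm)))
    (hdisj : ∀ i j, i ≠ j → Disjoint (MulAction.orbit M' (k i • x)) (MulAction.orbit M' (k j • x)))
    {i j : ι} (hij : i ≠ j)
    (g' g : C(A ⧸ LevelOrbit.pieceLattice M' (adelicUnitaryRat L V.Hm) (π.comp (Subgroup.inclusion hle)) x, ℂ)) :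
    ⟪(V.latticeModel hP).toQuotientModel.R (regimeEquiv L V.Hm h (k i))
        (V.regimePieceEmb hP h M' (π.comp (Subgroup.inclusion hle)) x hM' (hπ.comp (continuous_inclusion hle))
          g'),
      (V.latticeModel hP).toQuotientModel.R (regimeEquiv L V.Hm h (k j))
        (V.regimePieceEmb hP h M' (π.comp (Subgroup.inclusion hle)) x hM' (hπ.comp (continuous_inclusion hle))
          g)⟫_ℂ = 0 :=
  QuotientModel.inner_R_pieceEmb_eq_zero _ _ _ _ M π x M' hle hπ hM' k hk hkN hdisj hij g' g

/-- **Index law** in the END-STATE carrier. -/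
theorem inner_regimePieceEmb_eq_card_mul {ι : Type*} [Fintype ι]
    (hM : IsOpen (M : Set (adelicUnitaryGroup L V.Hm))) (hπ : Continuous π)
    (hM' : IsOpen (M' : Set (adelicUnitaryGroup L V.Hm))) (k : ι → M) (hk : ∀ i, π (k i) = 1)
    (hkN : ∀ i, (k i : adelicUnitaryGroup L V.Hm) ∈ Subgroup.normalizer (M' : Set (adelicUnitaryGroup L V.Hm)))
    (hdisj : ∀ i j, i ≠ j → Disjoint (MulAction.orbit M' (k i • x)) (MulAction.orbit M' (k j • x)))
    (hcover : MulAction.orbit M x ⊆ ⋃ i, MulAction.orbit M' (k i • x))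
    (f' f : C(A ⧸ LevelOrbit.pieceLattice M (adelicUnitaryRat L V.Hm) π x, ℂ)) :
    ⟪V.regimePieceEmb hP h M π x hM hπ f', V.regimePieceEmb hP h M π x hM hπ f⟫_ℂ =
      (Fintype.card ι : ℂ) *
        ⟪V.regimePieceEmb hP h M' (π.comp (Subgroup.inclusion hle)) x hM' (hπ.comp (continuous_inclusion hle))
            (f'.comp (LevelOrbit.levelCoverCM M (adelicUnitaryRat L V.Hm) π x M' hle)),
          V.regimePieceEmb hP h M' (π.comp (Subgroup.inclusion hle)) x hM' (hπ.comp (continuous_inclusion hle))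
            (f.comp (LevelOrbit.levelCoverCM M (adelicUnitaryRat L V.Hm) π x M' hle))⟫_ℂ :=
  QuotientModel.inner_pieceEmb_eq_card_mul _ _ _ _ M π x M' hle hM hπ hM' k hk hkN hdisj hcover f' f

end HermSpace3

end HodgeCM

end
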